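import Summits.Ventures.HodgeRepro2.A2LefschetzSplitting
import Summits.Ventures.HodgeRepro2.A2PrimitiveLefschetz
import Summits.Ventures.HodgeRepro2.A2LamPowWeilPeriod
import Summits.Ventures.HodgeRepro2.A2LiebermanModel

/-!
# The Weil projection is the primitive part; the Pontryagin and Lieberman classes have
proportional primitive parts (A2 annex, sl₂ — part 2)

* Every class in the image of `L = θ ∧ ·` has vanishing Weil coordinates
  (`weilProjModel_theta_mul`): the monomials `E_{univ∖P₀} ∧ w_{P₀,s}` dual to the Weil coordinates
  are killed by `θ`.  Hence the Weil projection of `x ∈ ⋀^k` is that of its primitive component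
  (`weilProjModel_eq_primPart`).
* `Λ^m L^{m+1} y` lies in the image of `L` (`lam_pow_lef_pow_succ_mem_map`): the sl₂-identities
  only ever lower the exponent of `L` to `1`.
* **Theorem** (`primPart_pontryagin_eq_smul_primPart_lefschetzInv`): for `z ∈ ⋀^{2n−k}`,
  `2 ≤ k ≤ n`, the primitive parts of Theorem A's class `z ⋆ θ^k` and of the Lieberman class
  `y'' = (L^{n−k})⁻¹ z` are proportional, `primPart (z ⋆ θ^k) = (n−k)!·k!·(∏ c_p)·vol • primPart y''`
  — the class-level form of row 104: the two constructions of (A9) agree on the primitive part (which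
  carries the Weil projection) and differ by a class in `L ⋀^{k−2}` (invisible to it, and non-zero
  in general: `A2LiebermanClassWitness`).
-/

namespace Summit.Ventures.HodgeRepro2.A2PrimitivePart

open WeilPlanes WeilIntegral WeilDetect WeilCoproduct A2HardLefschetzOps A2HardLefschetzMain
  A2PontryaginModel A2WeilProjection A2ModelDuality A2LiebermanModel A2PontryaginLefschetz
  A2LefschetzSplitting A2PrimitiveLefschetz A2LamPowWeilPeriod

variable {ι : Type*} [DecidableEq ι] [Fintype ι]

/-- The Weil projection is additive. -/
lemma weilProjModel_add (W : Finset (Finset ι × Bool)) (x x' : A ι) :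
    weilProjModel W (x + x') = weilProjModel W x + weilProjModel W x' := by
  simp only [weilProjModel, map_add, Finsupp.add_apply, add_smul, Finset.sum_add_distrib]

omit [Fintype ι] in
/-- `E_p = E_{{p}}`. -/
lemma ET_singleton (p : ι) : ET {p} = E p := by
  simp [ET, Ec]

/-- **`θ` kills the monomials dual to the Weil coordinates**: `θ ∧ E_{univ∖P₀} ∧ w_{P₀,s} = 0`
(`E_p²= 0` for `p ∉ P₀`, `E_p ∧ w_{P₀,s} = 0` for `p ∈ P₀`). -/
theorem theta_mul_ET_mul_weil_eq_zero (c : ι → ℂ) (P₀ : Finset ι) (s : Bool) :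
    theta c * (ET (Finset.univ \ P₀) * weil P₀ s) = 0 := by
  simp only [theta, Finset.sum_mul, smul_mul_assoc]
  refine Finset.sum_eq_zero fun p _ => ?_
  by_cases hp : p ∈ P₀
  · rw [← mul_assoc, (commute_E p _).eq, mul_assoc, E_mul_weil hp, mul_zero, smul_zero]
  · rw [← mul_assoc, ← ET_singleton, ET_mul_ET_of_not_disjoint, zero_mul, smul_zero]
    rw [Finset.not_disjoint_iff]
    exact ⟨p, Finset.mem_singleton_self p, Finset.mem_sdiff.2 ⟨Finset.mem_univ p, hp⟩⟩

/-- **The image of `L` has vanishing Weil coordinates**: `p_W(θ ∧ y) = 0` for every `y` and every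
family `W`. -/
theorem weilProjModel_theta_mul (c : ι → ℂ) (W : Finset (Finset ι × Bool)) (y : A ι) :
    weilProjModel W (theta c * y) = 0 := by
  apply weilProjModel_eq_zero_of_forall_integral
  intro d _
  rw [(commute_theta c y).eq, mul_assoc, theta_mul_ET_mul_weil_eq_zero, mul_zero, map_zero]

/-- **The Weil projection sees only the primitive part**: `p_W(x) = p_W(primPart x)` for
`x ∈ ⋀^k`, `k ≤ n`. -/
theorem weilProjModel_eq_primPart {c : ι → ℂ} (hc : ∀ p, c p ≠ 0) {k : ℕ}
    (hk : k ≤ Fintype.card ι) {x : A ι} (hx : x ∈ grading ι k) (W : Finset (Finset ι × Bool)) :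
    weilProjModel W x = weilProjModel W (primPart c hc hk hx) := by
  conv_lhs => rw [primPart_add_lef_lefPart c hc hk hx]
  rw [weilProjModel_add, weilProjModel_theta_mul, add_zero]

/-- `Λ^m` maps `⋀^{k+2m}` to `⋀^k`. -/
lemma lam_pow_mem_grading (c : ι → ℂ) (m : ℕ) {k : ℕ} {x : A ι}
    (hx : x ∈ grading ι (k + 2 * m)) : (lam c ^ m) x ∈ grading ι k := by
  induction m generalizing k with
  | zero => simpa using hx
  | succ m ih =>
    rw [pow_succ', Module.End.mul_apply]
    apply lam_mem_grading
    apply ih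
    rwa [show k + 2 + 2 * m = k + 2 * (m + 1) by ring]

/-- **`Λ` lowers the exponent of `L` by at most one**: `Λ` maps `L^{i+1}(⋀^d)` into `L^i(⋀^d)`. -/
theorem lam_mem_map_lef_pow {c : ι → ℂ} (hc : ∀ p, c p ≠ 0) {d i : ℕ} {x : A ι}
    (hx : x ∈ Submodule.map (lef c ^ (i + 1)) (grading ι d)) :
    lam c x ∈ Submodule.map (lef c ^ i) (grading ι d) := by
  obtain ⟨u, hu, rfl⟩ := hx
  rw [lam_lef_pow hc hu i]
  refine Submodule.add_mem _ ?_ (Submodule.smul_mem _ _ ⟨u, hu, rfl⟩)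
  refine ⟨lef c (lam c u), ?_, ?_⟩
  · have h1 : lam c u ∈ grading ι (d - 2) := by
      by_cases hd : d < 2
      · rw [lam_eq_zero_of_mem_lt_two c hd hu]; exact Submodule.zero_mem _
      · exact lam_mem_grading c (by rwa [show d - 2 + 2 = d by omega])
    have h2 := lef_mem_grading c h1
    by_cases hd : d < 2
    · rw [lam_eq_zero_of_mem_lt_two c hd hu, map_zero]; exact Submodule.zero_mem _
    · rwa [show d - 2 + 2 = d by omega] at h2
  · rw [pow_succ, Module.End.mul_apply]

/-- **`Λ^m L^{m+1} y` lies in the image of `L`**: `Λ^m L^{m+1} y = L w` with `w ∈ ⋀^d` for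
`y ∈ ⋀^d`. -/
theorem lam_pow_lef_pow_succ_mem_map {c : ι → ℂ} (hc : ∀ p, c p ≠ 0) {d : ℕ} {y : A ι}
    (hy : y ∈ grading ι d) (m : ℕ) :
    (lam c ^ m) ((lef c ^ (m + 1)) y) ∈ Submodule.map (lef c) (grading ι d) := by
  have key : ∀ j ≤ m + 1, (lam c ^ j) ((lef c ^ (m + 1)) y) ∈
      Submodule.map (lef c ^ (m + 1 - j)) (grading ι d) := by
    intro j
    induction j with
    | zero => intro _; exact ⟨y, hy, by simp⟩
    | succ j ih =>
      intro hj
      rw [pow_succ', Module.End.mul_apply]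
      have h := ih (by omega)
      rw [show m + 1 - j = m + 1 - (j + 1) + 1 by omega] at h
      exact lam_mem_map_lef_pow hc h
  have h := key m (by omega)
  rwa [show m + 1 - m = 1 by omega, pow_one] at h

/-- **Theorem A's class lies in `⋀^k`**: `z ⋆ θ^k = κ' Λ^{n−k} z ∈ ⋀^k` for `z ∈ ⋀^{2n−k}`. -/
theorem pontryagin_theta_pow_mem_grading {c : ι → ℂ} (hc : ∀ p, c p ≠ 0) {k : ℕ}
    (hk : k ≤ Fintype.card ι) {z : A ι} (hz : z ∈ grading ι (2 * Fintype.card ι - k)) :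
    pontryagin z (theta c ^ k) ∈ grading ι k := by
  rw [pontryagin_theta_pow_eq_smul_lam_pow hc hk z]
  refine Submodule.smul_mem _ _ (lam_pow_mem_grading c _ ?_)
  rwa [show k + 2 * (Fintype.card ι - k) = 2 * Fintype.card ι - k by omega]

/-- **The primitive parts of Theorem A's class and of the Lieberman class are proportional**:
for `z ∈ ⋀^{2n−k}`, `2 ≤ k ≤ n`, `primPart (z ⋆ θ^k) = (n−k)!·k!·(∏ c_p)·vol • primPart y''` with
`y'' = (L^{n−k})⁻¹ z`.  Proof: `y'' = v + L y` (`v` primitive), so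
`z ⋆ θ^k = κ' Λ^{n−k} L^{n−k} y'' = κ' ((n−k)!)² v + L w` with `w ∈ ⋀^{k−2}`, a primitive splitting. -/
theorem primPart_pontryagin_eq_smul_primPart_lefschetzInv {c : ι → ℂ} (hc : ∀ p, c p ≠ 0)
    {k : ℕ} (hk2 : 2 ≤ k) (hk : k ≤ Fintype.card ι) {z : A ι}
    (hz : z ∈ grading ι (2 * Fintype.card ι - k))
    (hy : pontryagin z (theta c ^ k) ∈ grading ι k) :
    primPart c hc hk hy =
      ((((Fintype.card ι - k).factorial : ℂ) * (k.factorial : ℂ) * ∏ p, c p) * vol ι) •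
        primPart c hc hk (lefschetzInv_mem c hc hk hz) := by
  set y'' := lefschetzInv c hc hk hz with hy''
  set v := primPart c hc hk (lefschetzInv_mem c hc hk hz) with hv
  set y := lefPart c hc hk (lefschetzInv_mem c hc hk hz) with hyy
  have hsplit : y'' = v + theta c * y := primPart_add_lef_lefPart c hc hk _
  have hvprim : lam c v = 0 := lam_primPart c hc hk _
  have hvmem : v ∈ grading ι k := primPart_mem c hc hk _
  have hymem : y ∈ grading ι (k - 2) := lefPart_mem c hc hk _
  -- `z = L^{n−k} v + L^{n−k+1} y`
  have hz' : z = (lef c ^ (Fintype.card ι - k)) v + (lef c ^ (Fintype.card ι - k + 1)) y := by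
    rw [← theta_pow_mul_lefschetzInv c hc hk hz, ← hy'', hsplit, mul_add, lef_pow_apply,
      lef_pow_apply, pow_succ, mul_assoc]
  -- `Λ^{n−k} L^{n−k+1} y = L w`, `w ∈ ⋀^{k−2}`
  obtain ⟨w, hw, hLw⟩ := lam_pow_lef_pow_succ_mem_map hc hymem (Fintype.card ι - k)
  -- the operator identity and the sl₂ constant
  have hpont : pontryagin z (theta c ^ k) =
      (kappa' c k * ((Fintype.card ι - k).factorial : ℂ) ^ 2) • v + lef c (kappa' c k • w) := by
    rw [pontryagin_theta_pow_eq_smul_lam_pow hc hk z, hz', map_add,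
      lam_pow_lef_pow_primitive hc hvmem hvprim, lefConst_card_sub _ _ hk, ← hLw, map_smul,
      smul_add, smul_smul]
  have hκ : kappa' c k * ((Fintype.card ι - k).factorial : ℂ) ^ 2 =
      (((Fintype.card ι - k).factorial : ℂ) * (k.factorial : ℂ) * ∏ p, c p) * vol ι := by
    rw [kappa']
    have hfac : ((Fintype.card ι - k).factorial : ℂ) ≠ 0 := by
      exact_mod_cast Nat.factorial_ne_zero _
    field_simp
  rw [hκ] at hpont
  have h1 : lam c (((((Fintype.card ι - k).factorial : ℂ) * (k.factorial : ℂ) * ∏ p, c p) *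
      vol ι) • v) = 0 := by
    rw [map_smul, hvprim, smul_zero]
  have h2 : kappa' c k • w ∈ grading ι (k - 2) := Submodule.smul_mem _ _ hw
  exact (primPart_eq_of_eq c hc hk2 hk hy h1 h2 hpont).symm

/-- **Row 104 through the primitive part**: `p_W(z ⋆ θ^k) = κ • p_W(primPart y'') = κ • p_W(y'')`. -/
theorem weilProjModel_pontryagin_eq_smul_primPart {c : ι → ℂ} (hc : ∀ p, c p ≠ 0) {k : ℕ}
    (hk2 : 2 ≤ k) (hk : k ≤ Fintype.card ι) {z : A ι} (hz : z ∈ grading ι (2 * Fintype.card ι - k))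
    (hy : pontryagin z (theta c ^ k) ∈ grading ι k) (W : Finset (Finset ι × Bool)) :
    weilProjModel W (pontryagin z (theta c ^ k)) =
      ((((Fintype.card ι - k).factorial : ℂ) * (k.factorial : ℂ) * ∏ p, c p) * vol ι) •
        weilProjModel W (primPart c hc hk (lefschetzInv_mem c hc hk hz)) := by
  rw [weilProjModel_eq_primPart hc hk hy, primPart_pontryagin_eq_smul_primPart_lefschetzInv hc hk2 hk hz hy,
    weilProjModel_smul]

/-- The proportionality of the primitive parts, with the degree of Theorem A's class supplied. -/
theorem primPart_pontryagin_eq_smul_primPart_lefschetzInv' {c : ι → ℂ} (hc : ∀ p, c p ≠ 0)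
    {k : ℕ} (hk2 : 2 ≤ k) (hk : k ≤ Fintype.card ι) {z : A ι}
    (hz : z ∈ grading ι (2 * Fintype.card ι - k)) :
    primPart c hc hk (pontryagin_theta_pow_mem_grading hc hk hz) =
      ((((Fintype.card ι - k).factorial : ℂ) * (k.factorial : ℂ) * ∏ p, c p) * vol ι) •
        primPart c hc hk (lefschetzInv_mem c hc hk hz) :=
  primPart_pontryagin_eq_smul_primPart_lefschetzInv hc hk2 hk hz _

end Summit.Ventures.HodgeRepro2.A2PrimitivePart
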